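import Summits.ABC.StewartYu.PadicW80ParLD
import Literature.NumberTheory.Transcendental.Waldschmidt1980SizeHyp
import HarnessLib

/-!
# The archimedean sizes at the `(log p)`-normalised parameter record, I

Support file (theorems only; no named fact), cell `abc-stewartyu` (p1, stub S5 of memo-03 §4): twin of p3's
`PadicW80Sizes.lean` on the `ℓ`-normalised record `PadicW80ParL` (p1's `PadicW80ParL{,A,B,C,D}.lean`), for a
sign-free `S : CW77.Setup` under `hy : S.SizeHyp P.V P.Vθ P.W`: the ARCHIMEDEAN size estimates of Waldschmidt 1980
§3.3–3.4 (moderate powers `≤ e^{𝔘/256}` / `≤ 𝔅`; height factors `≤ exp(c·𝔘/(2c_L'))`). Statements and proofs are the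
landed ones with the record renamed; the one numerical change is the sharp `log((X+h)/h) ≤ 6G` re-derived here
(`Xpt_div_hpar_le_six`: the factor `33/(2¹² m)` absorbs the class price's `e^{G}`), so that `ν(x,h)^k ≤ 𝔅` keeps the
landed margin. Everything is [folklore] book-keeping on [cite: Waldschmidt1980, §3.3–3.4 (pp. 268–270)].
-/

noncomputable section

open Finset Real
open Literature.NumberTheory.Transcendental
open Literature.NumberTheory.Transcendental.Baker1975
open Literature.NumberTheory.Transcendental.Baker1975.Ch3
open Literature.NumberTheory.Transcendental.CW77

namespace Summit.ABC.StewartYu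

open PadicW80Par (cTp cSp cLp cLp' Ap mRp)

namespace PadicW80ParL

variable {d : ℕ} (P : PadicW80ParL d)

/-! ### Moderate powers of the parameters -/

/-- Products of quantities `≤ 𝔅ⁱ`. [folklore] -/
theorem mul_le_𝔅_pow_p {a b : ℝ} {i j : ℕ} (ha : a ≤ P.𝔅ℓ ^ i) (hb : b ≤ P.𝔅ℓ ^ j) (hb0 : 0 ≤ b) :
    a * b ≤ P.𝔅ℓ ^ (i + j) := by
  rw [pow_add]
  have h𝔅 := P.𝔅_pos
  calc a * b ≤ P.𝔅ℓ ^ i * b := mul_le_mul_of_nonneg_right ha hb0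
    _ ≤ P.𝔅ℓ ^ i * P.𝔅ℓ ^ j := mul_le_mul_of_nonneg_left hb (by positivity)

/-- `2⁹⁰ m W⋆ ≤ 𝔘`. [folklore] -/
theorem mW_le_𝔘_p : (2 : ℝ) ^ 90 * (mRp d * P.Wstarℓ) ≤ P.𝔘ℓ := by
  have h := P.𝔘_ge
  have hG := P.one_le_nG; have hV := P.one_le_prodnVVθ; have hW := P.one_le_Wstar
  have hm2 : mRp d ≤ 2 ^ (d + 1) := by
    unfold mRp
    have : ((d : ℝ) + 1) = ((d + 1 : ℕ) : ℝ) := by push_cast; ring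
    rw [this]; exact_mod_cast (Nat.lt_two_pow_self).le
  have hd := P.hd
  have hpow : (2 : ℝ) ^ 90 * mRp d ≤ 2 ^ (49 * (d + 1)) := by
    calc (2 : ℝ) ^ 90 * mRp d ≤ 2 ^ 90 * 2 ^ (d + 1) := by gcongr
      _ = 2 ^ (91 + d) := by rw [← pow_add]; ring_nf
      _ ≤ 2 ^ (49 * (d + 1)) := pow_le_pow_right₀ (by norm_num) (by omega)
  have hGV : 1 ≤ P.nGℓ * ((∏ j, P.nV j) * P.nVθ) := by nlinarith
  calc (2 : ℝ) ^ 90 * (mRp d * P.Wstarℓ) = (2 ^ 90 * mRp d) * P.Wstarℓ := by ring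
    _ ≤ 2 ^ (49 * (d + 1)) * P.Wstarℓ := by gcongr
    _ = 2 ^ (49 * (d + 1)) * 1 * P.Wstarℓ := by ring
    _ ≤ 2 ^ (49 * (d + 1)) * (P.nGℓ * ((∏ j, P.nV j) * P.nVθ)) * P.Wstarℓ := by gcongr
    _ = 2 ^ (49 * (d + 1)) * P.nGℓ * ((∏ j, P.nV j) * P.nVθ) * P.Wstarℓ := by ring
    _ ≤ P.𝔘ℓ := h

/-- `T^T ≤ exp(𝔘/256)`. [folklore] -/
theorem T_pow_T_le_p : (P.Tℓ : ℝ) ^ P.Tℓ ≤ Real.exp (P.𝔘ℓ / 256) := by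
  have hT := P.T_pos
  rw [← Real.exp_log hT, ← Real.exp_nat_mul, Real.exp_le_exp]
  have h1 := P.log_T_le; have h2 := P.TWstar_le; have hU := P.𝔘_pos
  calc (P.Tℓ : ℝ) * Real.log P.Tℓ ≤ P.Tℓ * (10 * P.Wstarℓ) := mul_le_mul_of_nonneg_left h1 hT.le
    _ = 10 * (P.Tℓ * P.Wstarℓ) := by ring
    _ ≤ 10 * (P.𝔘ℓ / cTp) := by gcongr
    _ ≤ P.𝔘ℓ / 256 := by unfold cTp; nlinarith

/-- `T^k ≤ exp(𝔘/256)` for `k ≤ T`. [folklore] -/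
theorem T_pow_le_p {k : ℕ} (hk : k ≤ P.Tℓ) : (P.Tℓ : ℝ) ^ k ≤ Real.exp (P.𝔘ℓ / 256) := by
  have h1 : (1 : ℝ) ≤ P.Tℓ := by exact_mod_cast P.one_le_T
  exact (pow_le_pow_right₀ h1 hk).trans P.T_pow_T_le_p

/-- `2^{h L_b} ≤ exp(𝔘/256)`. [folklore] -/
theorem two_pow_hLb_le_p : (2 : ℝ) ^ (P.hparℓ * P.Lbℓ) ≤ Real.exp (P.𝔘ℓ / 256) := by
  have h2 : (2 : ℝ) = Real.exp (Real.log 2) := (Real.exp_log two_pos).symm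
  rw [h2, ← Real.exp_nat_mul, Real.exp_le_exp]
  push_cast
  have h1 := P.hparLb_le; have hW := P.Wstar_le_𝔘; have hU := P.𝔘_pos
  have hl2 : Real.log 2 ≤ 1 := by linarith [Real.log_two_lt_d9]
  have hl0 : 0 ≤ Real.log 2 := Real.log_nonneg one_le_two
  have h0 : (0 : ℝ) ≤ P.hparℓ * P.Lbℓ := by positivity
  calc ((P.hparℓ : ℝ) * P.Lbℓ) * Real.log 2 ≤ (P.hparℓ * P.Lbℓ) * 1 := mul_le_mul_of_nonneg_left hl2 h0
    _ ≤ P.𝔘ℓ / cLp + 4 * P.Wstarℓ := by linarith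
    _ ≤ P.𝔘ℓ / 256 := by unfold cLp; nlinarith

/-- `exp(𝔘/256)⁴ = 𝔅`. [folklore] -/
theorem exp_quarter_pow_four_p : Real.exp (P.𝔘ℓ / 256) ^ 4 = P.𝔅ℓ := by
  unfold 𝔅ℓ; rw [← Real.exp_nat_mul]; ring_nf

/-- **`X/h + 1 ≤ e^{6G}`** (sharp form of `Xpt_div_hpar_le`): keeping the factor `33/(2¹² m) ≤ 2⁻⁸`,
`X/h ≤ 2⁻⁸ · Mcl · Aᵐ m^{2m+3} (∏Vⱼ) G² ≤ 2⁻⁸ e^{6G}` and `2⁻⁸ e^{6G} + 1 ≤ e^{6G}`. [folklore] -/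
theorem Xpt_div_hpar_le_six : P.Xptℓ / P.hparℓ + 1 ≤ Real.exp (6 * P.Gℓ) := by
  have hh := P.hpar_pos; have hG := P.G_pos; have hW := P.one_le_Wstar; have hm := two_le_mR P
  have hm0 := mR_pos P; have hVf := P.hVmax1; have hVθ := P.hVθ1; have hV1 := P.one_le_prodVs
  have hM := P.hMcl
  -- Step 1: `X/h ≤ X G / W⋆`
  have h1 : P.Xptℓ / P.hparℓ ≤ P.Xptℓ * P.Gℓ / P.Wstarℓ := by
    rw [div_le_div_iff₀ hh (by linarith)]
    have := P.Wstar_div_G_lt_hpar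
    rw [div_lt_iff₀ hG] at this
    have hX := P.Xpt_nonneg
    nlinarith
  -- Step 2: `X G/W⋆ ≤ (33/(2^12 m)) · Mcl Ap^m m^{2m+3} (∏V) G²`
  set Z : ℝ := P.Mcl * (Ap ^ (d + 1) * mRp d ^ (2 * d + 3) * (∏ j, P.V j) * P.Gℓ ^ 2) with hZdef
  have hZ0 : 0 ≤ Z := by rw [hZdef]; unfold Ap; positivity
  have h2 : P.Xptℓ * P.Gℓ / P.Wstarℓ ≤ 33 / (2 ^ 12 * mRp d) * Z := by
    have hX := P.Xpt_le
    rw [div_le_iff₀ (by linarith)]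
    have hfac : (1 : ℝ) ≤ (d + 1).factorial := by exact_mod_cast Nat.one_le_iff_ne_zero.mpr (Nat.factorial_ne_zero _)
    have hUeq : P.Uℓ = P.Mcl * Ap ^ (d + 1) * (mRp d ^ (2 * d + 3) / (d + 1).factorial) * ((∏ j, P.nV j) * P.nVθ) *
        P.Wstarℓ * P.nGℓ := rfl
    unfold cLp' at hX
    rw [le_div_iff₀ (by positivity)] at hX
    have hA : (0 : ℝ) ≤ Ap ^ (d + 1) := by unfold Ap; positivity
    have hprod : (∏ j, P.nV j) ≤ ∏ j, P.V j :=
      prod_le_prod (fun j _ => le_trans zero_le_one (P.one_le_nV j)) fun j _ => P.nV_le j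
    have hnVθ : P.nVθ ≤ P.Vθ := P.nVθ_le
    have hnG : P.nGℓ ≤ P.Gℓ := by unfold nGℓ; exact div_le_self hG.le P.hℓ
    have hnV0 : 0 ≤ ∏ j, P.nV j := le_trans zero_le_one P.one_le_prodnV
    have hnVθ0 : 0 ≤ P.nVθ := le_trans zero_le_one P.one_le_nVθ
    have hnG0 : 0 ≤ P.nGℓ := P.nG_pos.le
    have key : P.Xptℓ * (2 ^ 12 * mRp d * P.Vθ) * P.Gℓ ≤ 33 * (Z * P.Wstarℓ * P.Vθ) := by
      have hdiv : mRp d ^ (2 * d + 3) / (d + 1).factorial ≤ mRp d ^ (2 * d + 3) := div_le_self (by positivity) hfac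
      calc P.Xptℓ * (2 ^ 12 * mRp d * P.Vθ) * P.Gℓ ≤ 33 * P.Uℓ * P.Gℓ := by nlinarith
        _ = 33 * (P.Mcl * (Ap ^ (d + 1) * (mRp d ^ (2 * d + 3) / (d + 1).factorial) * (∏ j, P.nV j) *
              (P.nGℓ * P.Gℓ)) * P.Wstarℓ * P.nVθ) := by rw [hUeq]; ring
        _ ≤ 33 * (P.Mcl * (Ap ^ (d + 1) * mRp d ^ (2 * d + 3) * (∏ j, P.V j) * (P.Gℓ * P.Gℓ)) * P.Wstarℓ * P.Vθ) := by
            gcongr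
        _ = 33 * (Z * P.Wstarℓ * P.Vθ) := by rw [hZdef]; ring
    -- divide `key` by `2^12 m V_θ`: `X G W⋆⁻¹·W⋆ ... `
    have hden : (0 : ℝ) < 2 ^ 12 * mRp d * P.Vθ := by positivity
    have : P.Xptℓ * P.Gℓ ≤ 33 / (2 ^ 12 * mRp d) * Z * P.Wstarℓ := by
      rw [show 33 / (2 ^ 12 * mRp d) * Z * P.Wstarℓ = 33 * (Z * P.Wstarℓ * P.Vθ) / (2 ^ 12 * mRp d * P.Vθ) by
        field_simp]
      rw [le_div_iff₀ hden]
      calc P.Xptℓ * P.Gℓ * (2 ^ 12 * mRp d * P.Vθ) = P.Xptℓ * (2 ^ 12 * mRp d * P.Vθ) * P.Gℓ := by ring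
        _ ≤ 33 * (Z * P.Wstarℓ * P.Vθ) := key
    linarith
  -- Step 3: `Z ≤ e^{6G}` and `33/(2^12 m) ≤ 2⁻⁸`
  have f1 := P.A_pow_mul_le
  have f3 := P.prodV_le_exp_G
  have f4 := P.G_sq_le_exp_G
  have f0 : P.Mcl ≤ Real.exp P.Gℓ := by
    have h1 : Real.log P.Mcl ≤ P.Gℓ := P.hMclℓ.trans P.ℓ_le_G
    calc P.Mcl = Real.exp (Real.log P.Mcl) := (Real.exp_log (by linarith)).symm
      _ ≤ Real.exp P.Gℓ := Real.exp_le_exp.mpr h1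
  have h3 : Z ≤ Real.exp (6 * P.Gℓ) := by
    rw [hZdef]
    calc P.Mcl * (Ap ^ (d + 1) * mRp d ^ (2 * d + 3) * (∏ j, P.V j) * P.Gℓ ^ 2)
        = P.Mcl * ((Ap ^ (d + 1) * mRp d ^ (2 * d + 3)) * (∏ j, P.V j) * P.Gℓ ^ 2) := by ring
      _ ≤ Real.exp P.Gℓ * (Real.exp (3 * P.Gℓ) * Real.exp P.Gℓ * Real.exp P.Gℓ) := by
          have : (0 : ℝ) ≤ Ap ^ (d + 1) * mRp d ^ (2 * d + 3) := by unfold Ap; positivity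
          gcongr
      _ = Real.exp (6 * P.Gℓ) := by simp only [← Real.exp_add]; ring_nf
  have hc : 33 / (2 ^ 12 * mRp d) ≤ (1 : ℝ) / 2 ^ 7 := by
    rw [div_le_div_iff₀ (by positivity) (by norm_num)]; nlinarith
  have hE1 : (2 : ℝ) ≤ Real.exp (6 * P.Gℓ) := by
    have := Real.add_one_le_exp (6 * P.Gℓ); have := P.one_le_G; linarith
  have h4 : 33 / (2 ^ 12 * mRp d) * Z + 1 ≤ Real.exp (6 * P.Gℓ) := by
    have : 33 / (2 ^ 12 * mRp d) * Z ≤ (1 : ℝ) / 2 ^ 7 * Real.exp (6 * P.Gℓ) :=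
      mul_le_mul hc h3 hZ0 (by norm_num)
    linarith
  linarith [h1, h2, h4]

/-- **`log((X + h)/h) ≤ 6 G`** (sharp form). [cite: Waldschmidt1980, (3.13)–(3.14) (p. 265)] -/
theorem log_Xpt_div_le_six : Real.log ((P.Xptℓ + P.hparℓ) / P.hparℓ) ≤ 6 * P.Gℓ := by
  have hh := P.hpar_pos
  have e : (P.Xptℓ + P.hparℓ) / P.hparℓ = P.Xptℓ / P.hparℓ + 1 := by field_simp
  rw [e]
  have h := P.Xpt_div_hpar_le_six
  have hpos : 0 < P.Xptℓ / P.hparℓ + 1 := by have := P.Xpt_nonneg; positivity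
  calc Real.log (P.Xptℓ / P.hparℓ + 1) ≤ Real.log (Real.exp (6 * P.Gℓ)) := Real.log_le_log hpos h
    _ = 6 * P.Gℓ := Real.log_exp _

/-- **`(e(x+h)/h)^{h L_b} ≤ exp(𝔘/256)`** for `x ≤ Xpt`. [cite: Waldschmidt1980, (3.13)–(3.14) (p. 265)] -/
theorem ratio_pow_le_p {x : ℕ} (hx : (x : ℝ) ≤ P.Xptℓ) :
    (Real.exp 1 * ((x : ℝ) + P.hparℓ) / P.hparℓ) ^ (P.hparℓ * P.Lbℓ) ≤ Real.exp (P.𝔘ℓ / 256) := by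
  have hh := P.hpar_pos
  have hbase : 1 ≤ Real.exp 1 * ((x : ℝ) + P.hparℓ) / P.hparℓ := by
    rw [le_div_iff₀ hh]
    have := Real.exp_one_gt_two; have := Nat.cast_nonneg (α := ℝ) x
    nlinarith
  have hpos : 0 < Real.exp 1 * ((x : ℝ) + P.hparℓ) / P.hparℓ := by linarith
  rw [← Real.exp_log hpos, ← Real.exp_nat_mul, Real.exp_le_exp]
  have h1 : Real.log (Real.exp 1 * ((x : ℝ) + P.hparℓ) / P.hparℓ) =
      1 + Real.log (((x : ℝ) + P.hparℓ) / P.hparℓ) := by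
    rw [mul_div_assoc, Real.log_mul (Real.exp_pos 1).ne' (by positivity), Real.log_exp]
  rw [h1]
  have h2 : Real.log (((x : ℝ) + P.hparℓ) / P.hparℓ) ≤ 6 * P.Gℓ := by
    refine le_trans (Real.log_le_log (by positivity) ?_) P.log_Xpt_div_le_six
    exact div_le_div_of_nonneg_right (by linarith) hh.le
  have hG := P.one_le_G
  have h3 := P.hparLbG_le; have hW := P.Wstar_le_𝔘; have hGU := P.G_le_𝔘; have hU := P.𝔘_pos
  have h0 : (0 : ℝ) ≤ P.hparℓ * P.Lbℓ := by positivity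
  push_cast
  calc ((P.hparℓ : ℝ) * P.Lbℓ) * (1 + Real.log (((x : ℝ) + P.hparℓ) / P.hparℓ))
      ≤ (P.hparℓ * P.Lbℓ) * (7 * P.Gℓ) := mul_le_mul_of_nonneg_left (by linarith) h0
    _ = 7 * (P.hparℓ * P.Lbℓ * P.Gℓ) := by ring
    _ ≤ 7 * (P.𝔘ℓ / cLp + (P.Wstarℓ + P.Gℓ)) := by gcongr
    _ ≤ P.𝔘ℓ / 256 := by unfold cLp; nlinarith

/-- **`ν(x, h)^k ≤ 𝔅`** for `x ≤ Xpt`, `k ≤ T`. [cite: Waldschmidt1980, §3.4 (3.21) (p. 269)] -/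
theorem nuBound_pow_le_𝔅_p {x k : ℕ} (hx : (x : ℝ) ≤ P.Xptℓ) (hk : k ≤ P.Tℓ) :
    ((nuBound x P.hparℓ : ℕ) : ℝ) ^ k ≤ P.𝔅ℓ := by
  have hν1 : (1 : ℝ) ≤ nuBound x P.hparℓ := by exact_mod_cast nuBound_pos x P.hparℓ
  refine (pow_le_pow_right₀ hν1 hk).trans (P.le_𝔅_of_log_le ?_)
  rw [Real.log_pow]
  have h1 := Waldschmidt1980.W80Par.log_nuBound_le_one_le (x := x) P.one_le_hpar
  have hh := P.hpar_pos
  have h2 : Real.log (((x : ℝ) + P.hparℓ) / P.hparℓ) ≤ 6 * P.Gℓ := by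
    refine le_trans (Real.log_le_log (by positivity) ?_) P.log_Xpt_div_le_six
    exact div_le_div_of_nonneg_right (by linarith) hh.le
  have hG := P.one_le_G
  have h3 : Real.log (nuBound x P.hparℓ) ≤ P.hparℓ * (60 * P.Gℓ) := by
    refine h1.trans (mul_le_mul_of_nonneg_left ?_ hh.le)
    linarith
  have hT := P.T_pos; have hTW := P.TWstar_le; have hGW := P.G_le_three_Wstar; have hhG := P.hparG_le
  have hU := P.𝔘_pos
  calc (P.Tℓ : ℝ) * Real.log (nuBound x P.hparℓ) ≤ P.Tℓ * (P.hparℓ * (60 * P.Gℓ)) :=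
        mul_le_mul_of_nonneg_left h3 hT.le
    _ = 60 * P.Tℓ * (P.hparℓ * P.Gℓ) := by ring
    _ ≤ 60 * P.Tℓ * (P.Wstarℓ + P.Gℓ) := by gcongr
    _ ≤ 60 * P.Tℓ * (4 * P.Wstarℓ) := by gcongr; linarith
    _ = 240 * (P.Tℓ * P.Wstarℓ) := by ring
    _ ≤ 240 * (P.𝔘ℓ / cTp) := by gcongr
    _ ≤ P.𝔘ℓ / 64 := by unfold cTp; nlinarith

/-! ### The linear-form constant `Γ = 2 U e^W` and the ranges against `U` -/

/-- `log(2 U e^W) ≤ 11 W⋆ + 1`. [folklore] -/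
theorem log_Γ_le_p : Real.log (2 * P.Uℓ * Real.exp P.W) ≤ 11 * P.Wstarℓ + 1 := by
  have hU := P.U_pos
  rw [Real.log_mul (by positivity) (Real.exp_pos _).ne', Real.log_mul (by norm_num) hU.ne', Real.log_exp]
  have h1 := P.log_U_le; have h2 := P.W_le_Wstar
  have h3 : Real.log 2 ≤ 1 := by have := Real.log_two_lt_d9; linarith
  linarith

/-- `1 ≤ 2 U e^W`. [folklore] -/
theorem one_le_Γ_p : (1 : ℝ) ≤ 2 * P.Uℓ * Real.exp P.W := by
  have hW : 1 ≤ Real.exp P.W := Real.one_le_exp (by linarith [P.hW])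
  have hU : 1 ≤ P.Uℓ := by
    have := P.U_div_ge'; have hW1 := P.one_le_Wstar
    have h2 : (1 : ℝ) ≤ 2 ^ (49 * (d + 1)) := one_le_pow₀ (by norm_num)
    have h3 : P.Uℓ / (2 ^ (d + 1) * P.Wstarℓ) ≤ P.Uℓ := div_le_self P.U_pos.le (by
      have : (1 : ℝ) ≤ 2 ^ (d + 1) := one_le_pow₀ (by norm_num)
      nlinarith)
    linarith
  nlinarith

/-- `Lⱼ ≤ U`. [cite: Waldschmidt1980, (3.4) (p. 264)] -/
theorem Lp_le_U (j : Fin d) : (P.Lℓ j : ℝ) ≤ P.Uℓ := by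
  have hU := P.U_pos
  have hden : 1 ≤ cLp' * mRp d * 2 ^ (d + 2) * P.S₀ℓ * P.V j := by
    have hm := two_le_mR P; have hS : (2 : ℝ) ≤ P.S₀ℓ := by exact_mod_cast P.two_le_S₀
    have hV := P.hV j
    have h4 : (1 : ℝ) ≤ 2 ^ (d + 2) := one_le_pow₀ (by norm_num)
    unfold cLp'
    have h5 : (1 : ℝ) ≤ 2 ^ 12 * mRp d := by nlinarith
    calc (1 : ℝ) ≤ 2 ^ 12 * mRp d := h5
      _ ≤ 2 ^ 12 * mRp d * 2 ^ (d + 2) := le_mul_of_one_le_right (by positivity) h4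
      _ ≤ 2 ^ 12 * mRp d * 2 ^ (d + 2) * P.S₀ℓ := le_mul_of_one_le_right (by positivity) (by linarith)
      _ ≤ 2 ^ 12 * mRp d * 2 ^ (d + 2) * P.S₀ℓ * P.V j := le_mul_of_one_le_right (by positivity) hV
  unfold Lℓ
  calc (⌊P.Uℓ / (cLp' * mRp d * 2 ^ (d + 2) * P.S₀ℓ * P.V j)⌋₊ : ℝ)
      ≤ P.Uℓ / (cLp' * mRp d * 2 ^ (d + 2) * P.S₀ℓ * P.V j) := Nat.floor_le (by positivity)
    _ ≤ P.Uℓ := div_le_self hU.le hden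

/-- `L_θ ≤ U`. [cite: Waldschmidt1980, (3.4) (p. 264)] -/
theorem Lθp_le_U : (P.Lθℓ : ℝ) ≤ P.Uℓ := by
  have hU := P.U_pos
  have hden : 1 ≤ cLp' * mRp d * 2 ^ (d + 2) * P.S₀ℓ * P.Vθ := by
    have hm := two_le_mR P; have hS : (2 : ℝ) ≤ P.S₀ℓ := by exact_mod_cast P.two_le_S₀
    have hV := P.hVθ1
    have h4 : (1 : ℝ) ≤ 2 ^ (d + 2) := one_le_pow₀ (by norm_num)
    unfold cLp'
    have h5 : (1 : ℝ) ≤ 2 ^ 12 * mRp d := by nlinarith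
    calc (1 : ℝ) ≤ 2 ^ 12 * mRp d := h5
      _ ≤ 2 ^ 12 * mRp d * 2 ^ (d + 2) := le_mul_of_one_le_right (by positivity) h4
      _ ≤ 2 ^ 12 * mRp d * 2 ^ (d + 2) * P.S₀ℓ := le_mul_of_one_le_right (by positivity) (by linarith)
      _ ≤ 2 ^ 12 * mRp d * 2 ^ (d + 2) * P.S₀ℓ * P.Vθ := le_mul_of_one_le_right (by positivity) hV
  exact P.Lθ_le.trans (div_le_self hU.le hden)

/-- `Lallᵢ ≤ U`. [cite: Waldschmidt1980, (3.4) (p. 264)] -/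
theorem Lallp_le_U (i : Fin (d + 1)) : (P.Lallℓ i : ℝ) ≤ P.Uℓ := by
  refine Fin.lastCases ?_ (fun j => ?_) i
  · rw [P.Lall_last]; exact P.Lθp_le_U
  · rw [P.Lall_castSucc]; exact P.Lp_le_U j

/-- `∑ᵢ Lallᵢ Vallᵢ = ∑ⱼ LⱼVⱼ + L_θ V_θ`. [folklore] -/
theorem sum_Lallp_Vallp : ∑ i, (P.Lallℓ i : ℝ) * P.Vallℓ i = (∑ j, (P.Lℓ j : ℝ) * P.V j) + P.Lθℓ * P.Vθ := by
  rw [Fin.sum_univ_castSucc]; simp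

/-- **`S₀ ∑ᵢ Lallᵢ Vallᵢ ≤ 𝔘/(2c_L')`** ((3.11) at the `p`-adic parameters). [cite: Waldschmidt1980, (3.11) (p. 265)] -/
theorem S₀p_sum_LV_le : (P.S₀ℓ : ℝ) * ∑ i, (P.Lallℓ i : ℝ) * P.Vallℓ i ≤ P.𝔘ℓ / (2 * cLp') := by
  rw [P.sum_Lallp_Vallp]; exact P.S₀LV_le

/-- **`∑ eᵢ Vallᵢ ≤ c 𝔘/(2c_L')`** when `eᵢ ≤ c Lallᵢ S₀`. [cite: Waldschmidt1980, (3.11) (p. 265)] -/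
theorem sum_eVp_le {e : Fin (d + 1) → ℕ} {c : ℕ} (he : ∀ i, e i ≤ c * P.Lallℓ i * P.S₀ℓ) :
    ∑ i, (e i : ℝ) * P.Vallℓ i ≤ c * (P.𝔘ℓ / (2 * cLp')) := by
  have h1 : ∑ i, (e i : ℝ) * P.Vallℓ i ≤ c * (P.S₀ℓ * ∑ i, (P.Lallℓ i : ℝ) * P.Vallℓ i) := by
    rw [mul_sum, mul_sum]
    refine sum_le_sum fun i _ => ?_
    have : (e i : ℝ) ≤ c * P.Lallℓ i * P.S₀ℓ := by exact_mod_cast he i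
    have hV := (P.Vall_pos i).le
    calc (e i : ℝ) * P.Vallℓ i ≤ (c * P.Lallℓ i * P.S₀ℓ) * P.Vallℓ i := mul_le_mul_of_nonneg_right this hV
      _ = c * (P.S₀ℓ * ((P.Lallℓ i : ℝ) * P.Vallℓ i)) := by ring
  exact h1.trans (mul_le_mul_of_nonneg_left P.S₀p_sum_LV_le (Nat.cast_nonneg _))

end PadicW80ParL

end Summit.ABC.StewartYu

end
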